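import Literature.IUT.HodgeTheaters.LabelsPlusMinusOfCuspTorsors
import Literature.IUT.HodgeTheaters.Labels

/-!
# [IUTchI] Def 6.1 (v): `𝔽_l^⋇ = 𝔽_l^×/{±1}` plumbing and UNIT-EQUIVARIANT maps of cusp torsors

S. Mochizuki, *Inter-universal Teichmüller theory I*, kurims manuscript (May 2020), §6 Definition 6.1 (v)
p. 158: "this rank one quotient determines a natural surjective homomorphism `Aut(𝒟^{⊚±}) ↠ 𝔽_l^⋇` … whose
kernel we denote by `Aut_±(𝒟^{⊚±})`", "`Aut_±(𝒟^{⊚±})` … acts transitively on the cusps of `X_K`",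
"`Aut_csp(𝒟^{⊚±}) ⊆ Aut_±(𝒟^{⊚±})` … the subgroup of automorphisms that fix the cusps of `X_K`", "natural outer
isomorphisms `Aut_K(X_K) ⥲ Aut_±(𝒟^{⊚±})/Aut_csp(𝒟^{⊚±}) ⥲ 𝔽_l^{⋊±}`" ([IUTchI] Def 6.1 (v) p.158)
[claim: Mochizuki2012, status: disputed] (D-0012 claim key, series status DISPUTED — this file is FINITE GROUP
THEORY over `ZMod l`; nothing of the series is asserted and no side is taken on [IUTchIII] Cor. 3.12).

## Why (KIT-INSTANCE row D13-P3-v; abc-iut-L5-lead RULINGS #25 (7) / #28 (2); abc-iut-L5-t4 lemma list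
03:58:14Z, items (L4) + the `𝔽_l^⋇` side of (L3); companion file `PiAvatarRankOneExponent.lean` = (L1), (L2a/b))

At the genuine instance of abc-iut-L5-t4's `PMBaseKit` the kit field `toFlStar : Aut(𝒟^{⊚±}) → 𝔽_l^⋇` is (the unit
`u ∈ (ℤ/l)^×` by which an automorphism acts on the RANK ONE QUOTIENT `Gal(X̲_K/X_K) ≅ ℤ/l`) modulo `{±1}`, and the
same automorphism permutes the cusps — a `ℤ/l`-torsor `S`, whose `𝔽_l^±`-torsor structure is P3's
`FlPMTorsor.ofAddTorsor l S` (p418664) — `u`-EQUIVARIANTLY: `f (q +ᵥ s) = (u·q) +ᵥ f s`.  This file supplies: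

* §1 `𝔽_l^⋇` plumbing over abc-iut-L5-t3's `FlStar l = (ZMod l)ˣ ⧸ unitsPlusMinus l`: `FlStar.mk_eq_mk_iff`
  (`↔ u = v ∨ u = -v`), `mk_eq_one_iff(_val)`, and for ANY character `χ : G →* (ℤ/l)^×` the kernel
  (`mem_ker_mk'_comp_iff`: `χ g = ±1` — the shape of `Aut_± = Ker`) and the surjectivity criterion
  (`mk'_comp_surjective_iff`: every unit is, up to sign, a value of `χ`) of `χ` modulo `±1` — so the kit's
  `toFlStar_surjective` reduces to the split-torus sentence of Def 3.1 (c), which stays with the binding;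
* §2 unit-equivariant maps: the factor `u` is unique (`unitEquivariant_unique`), multiplicative
  (`unitEquivariant_comp`, `…_symm`), a unit for injective maps (`isUnit_of_unitEquivariant_injective`), EQUAL TO
  `1` FOR A MAP FIXING THE CUSPS (`unitEquivariant_eq_one_of_forall_eq` — the `autCsp_le` shape), and
  `f ∈ Aut_±(T)` IFF `u = ±1` IFF the label of `u` in `𝔽_l^⋇` is `1` (`FlPMTorsor.mem_autPM_iff_of_unitEquivariant`,
  `…_iff_mk_eq_one`, `trans_mem_ofAddTorsor_charts_iff` — the torsor side of `gLab_range`); (L4)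
  `FlPMTorsor.exists_semiEquivariant_of_mem_autPM` = the converse of P3's `mem_autPM_of_semiEquivariant`, and the
  rigidity "acts trivially ⇒ sign `+1` / reads as `1 ∈ 𝔽_l^{⋊±}`" (`IsSemiEquivariant.eq_one_of_forall_eq`,
  `FlPMTorsor.eq_one_of_forall_chart_smul_eq`, `…smul_eq_one_of_mem_autPM_of_forall_eq`).

Proof-only (0 definitions, no instance, no notation, no `Prop` fact); Mathlib + `Labels` + `LabelsPlusMinus*`.
typed ≠ proved elsewhere.
-/

namespace Literature.IUT.HodgeTheaters

/-! ### §1 `𝔽_l^⋇ = 𝔽_l^× / {±1}`: classes, kernel and surjectivity of a character modulo `±1` -/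

namespace FlStar

variable {l : ℕ}

/-- Every label `∈ 𝔽_l^⋇` is the class of a unit ([IUTchI] §4 p. 95 "`𝔽_l^⋇ := 𝔽_l^×/{±1}`").
([IUTchI] Def 6.1 (v) p.158) [claim: Mochizuki2012, status: disputed] -/
theorem mk_surjective : Function.Surjective (FlStar.mk l) := QuotientGroup.mk_surjective

/-- Two units have the same label in `𝔽_l^⋇` iff they agree up to sign.
([IUTchI] Def 6.1 (v) p.158) [claim: Mochizuki2012, status: disputed] -/
theorem mk_eq_mk_iff (u v : (ZMod l)ˣ) : FlStar.mk l u = FlStar.mk l v ↔ u = v ∨ u = -v := by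
  rw [FlStar.mk, FlStar.mk, QuotientGroup.eq, mem_unitsPlusMinus_iff, inv_mul_eq_one,
    inv_mul_eq_iff_eq_mul, mul_neg_one]
  constructor
  · rintro (h | h)
    · exact Or.inl h
    · exact Or.inr (by rw [h, neg_neg])
  · rintro (h | h)
    · exact Or.inl h
    · exact Or.inr (by rw [h, neg_neg])

/-- `u` and `−u` have the same label. ([IUTchI] Def 6.1 (v) p.158) [claim: Mochizuki2012, status: disputed] -/
theorem mk_neg (u : (ZMod l)ˣ) : FlStar.mk l (-u) = FlStar.mk l u :=
  (mk_eq_mk_iff _ _).mpr (Or.inr rfl)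

/-- The label of `u` is trivial iff `u = ±1` (units form).
([IUTchI] Def 6.1 (v) p.158) [claim: Mochizuki2012, status: disputed] -/
theorem mk_eq_one_iff (u : (ZMod l)ˣ) : FlStar.mk l u = 1 ↔ u = 1 ∨ u = -1 := by
  rw [FlStar.mk, QuotientGroup.eq_one_iff, mem_unitsPlusMinus_iff]

/-- The label of `u` is trivial iff `u = ±1` (residues form).
([IUTchI] Def 6.1 (v) p.158) [claim: Mochizuki2012, status: disputed] -/
theorem mk_eq_one_iff_val (u : (ZMod l)ˣ) :
    FlStar.mk l u = 1 ↔ (u : ZMod l) = 1 ∨ (u : ZMod l) = -1 := by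
  rw [mk_eq_one_iff, Units.ext_iff, Units.ext_iff, Units.val_one, Units.val_neg, Units.val_one]

/-- A character `χ : G → 𝔽_l^×` followed by `𝔽_l^× ↠ 𝔽_l^⋇` sends `g` to the label of `χ g` (the shape of the kit's
`toFlStar := (𝔽_l^× ↠ 𝔽_l^⋇) ∘ (exponent on the rank one quotient)`).
([IUTchI] Def 6.1 (v) p.158) [claim: Mochizuki2012, status: disputed] -/
theorem mk'_comp_apply {G : Type*} [Group G] (χ : G →* (ZMod l)ˣ) (g : G) :
    (QuotientGroup.mk' (unitsPlusMinus l)).comp χ g = FlStar.mk l (χ g) := rfl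

/-- The kernel of `χ` modulo `±1` — the shape of `Aut_±(𝒟^{⊚±}) = Ker(Aut ↠ 𝔽_l^⋇)`: `g` acts by `±1`.
([IUTchI] Def 6.1 (v) p.158) [claim: Mochizuki2012, status: disputed] -/
theorem mem_ker_mk'_comp_iff {G : Type*} [Group G] (χ : G →* (ZMod l)ˣ) (g : G) :
    g ∈ ((QuotientGroup.mk' (unitsPlusMinus l)).comp χ).ker ↔ χ g = 1 ∨ χ g = -1 := by
  rw [MonoidHom.mem_ker, mk'_comp_apply, mk_eq_one_iff]

/-- **Surjectivity criterion for `Aut ↠ 𝔽_l^⋇`**: `χ` modulo `±1` is surjective iff every unit is, UP TO SIGN, a value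
of `χ` (at the instance: "the image … contains a Borel subgroup of `SL₂(𝔽_l)/{±1}`", whose split torus acts on the
rank one quotient by every unit). ([IUTchI] Def 6.1 (v) p.158) [claim: Mochizuki2012, status: disputed] -/
theorem mk'_comp_surjective_iff {G : Type*} [Group G] (χ : G →* (ZMod l)ˣ) :
    Function.Surjective ((QuotientGroup.mk' (unitsPlusMinus l)).comp χ) ↔
      ∀ u : (ZMod l)ˣ, ∃ g : G, χ g = u ∨ χ g = -u := by
  constructor
  · intro h u
    obtain ⟨g, hg⟩ := h (FlStar.mk l u)
    rw [mk'_comp_apply, mk_eq_mk_iff] at hg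
    exact ⟨g, hg⟩
  · intro h x
    obtain ⟨u, rfl⟩ := mk_surjective x
    obtain ⟨g, hg⟩ := h u
    exact ⟨g, by rw [mk'_comp_apply, mk_eq_mk_iff]; exact hg⟩

/-- In particular a surjective character stays surjective modulo `±1`.
([IUTchI] Def 6.1 (v) p.158) [claim: Mochizuki2012, status: disputed] -/
theorem mk'_comp_surjective_of_surjective {G : Type*} [Group G] {χ : G →* (ZMod l)ˣ}
    (hχ : Function.Surjective χ) :
    Function.Surjective ((QuotientGroup.mk' (unitsPlusMinus l)).comp χ) :=
  (mk'_comp_surjective_iff χ).mpr fun u => by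
    obtain ⟨g, hg⟩ := hχ u
    exact ⟨g, Or.inl hg⟩

end FlStar

/-! ### §2 Unit-equivariant maps of cusp torsors (`f (q +ᵥ s) = (u·q) +ᵥ f s`, `u ∈ ℤ/l`)

An automorphism of `𝒟^{⊚±}` normalises `Gal(X̲_K/X_K) ≅ ℤ/l`, acting on it by the unit `u` of the rank one
quotient, and permutes the cusps — a `ℤ/l`-torsor — compatibly: `u`-equivariantly.  abc-iut-L5-t4's P3
`IsSemiEquivariant ε` is the case `u = ε ∈ {±1}` (`isSemiEquivariant_iff_cast`). -/

section UnitEquivariant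

variable {l : ℕ} {S S' S'' : Type*} [AddTorsor (ZMod l) S] [AddTorsor (ZMod l) S']
  [AddTorsor (ZMod l) S'']

/-- Sign-equivariance (P3) is unit-equivariance for the unit `ε ∈ {±1} ⊆ (ℤ/l)^×`.
([IUTchI] Def 6.1 (i) p.155) [claim: Mochizuki2012, status: disputed] -/
theorem isSemiEquivariant_iff_cast (ε : ℤˣ) (f : S ≃ S') :
    IsSemiEquivariant (l := l) ε f ↔
      ∀ (q : ZMod l) (s : S), f (q +ᵥ s) = (((ε : ℤ) : ZMod l) * q) +ᵥ f s := by
  simp only [IsSemiEquivariant, Units.smul_def, zsmul_eq_mul]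

/-- The factor `u` of a unit-equivariant map is determined by the map (cusp torsors are nonempty).
([IUTchI] Def 6.1 (v) p.158) [claim: Mochizuki2012, status: disputed] -/
theorem unitEquivariant_unique {u u' : ZMod l} {f : S → S'}
    (hf : ∀ (q : ZMod l) (s : S), f (q +ᵥ s) = (u * q) +ᵥ f s)
    (hf' : ∀ (q : ZMod l) (s : S), f (q +ᵥ s) = (u' * q) +ᵥ f s) : u = u' := by
  obtain ⟨s⟩ := (inferInstance : Nonempty S)
  have h := (hf 1 s).symm.trans (hf' 1 s)
  rw [mul_one, mul_one] at h
  exact vadd_right_cancel (f s) h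

/-- **The `Aut_csp` shape** ([IUTchI] Def 6.1 (v) p.158: automorphisms fixing the cusps lie in `Aut_±`, indeed map to
`1 ∈ 𝔽_l^⋇` — the kit field `autCsp_le`): a unit-equivariant self-map FIXING ALL CUSPS has factor `u = 1`.
([IUTchI] Def 6.1 (v) p.158) [claim: Mochizuki2012, status: disputed] -/
theorem unitEquivariant_eq_one_of_forall_eq {u : ZMod l} {f : S → S}
    (hf : ∀ (q : ZMod l) (s : S), f (q +ᵥ s) = (u * q) +ᵥ f s) (hid : ∀ s, f s = s) : u = 1 := by
  obtain ⟨s⟩ := (inferInstance : Nonempty S)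
  have h := hf 1 s
  rw [hid, hid, mul_one] at h
  exact (vadd_right_cancel s h).symm

/-- A unit-equivariant self-map fixing ONE cusp acts on every cusp `q +ᵥ s₀` as `q ↦ u·q`; in particular a
non-trivial factor `u ≠ 1` moves some cusp (contrapositive form of `unitEquivariant_eq_one_of_forall_eq`).
([IUTchI] Def 6.1 (v) p.158) [claim: Mochizuki2012, status: disputed] -/
theorem unitEquivariant_apply_of_apply_eq {u : ZMod l} {f : S → S}
    (hf : ∀ (q : ZMod l) (s : S), f (q +ᵥ s) = (u * q) +ᵥ f s) {s₀ : S} (h0 : f s₀ = s₀) (q : ZMod l) :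
    f (q +ᵥ s₀) = (u * q) +ᵥ s₀ := by
  rw [hf, h0]

/-- Factors MULTIPLY under composition (the exponent is a homomorphism `Aut → (ℤ/l)^×`).
([IUTchI] Def 6.1 (v) p.158) [claim: Mochizuki2012, status: disputed] -/
theorem unitEquivariant_comp {u v : ZMod l} {f : S → S'} {g : S' → S''}
    (hf : ∀ (q : ZMod l) (s : S), f (q +ᵥ s) = (u * q) +ᵥ f s)
    (hg : ∀ (q : ZMod l) (s : S'), g (q +ᵥ s) = (v * q) +ᵥ g s) :
    ∀ (q : ZMod l) (s : S), g (f (q +ᵥ s)) = ((v * u) * q) +ᵥ g (f s) := fun q s => by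
  rw [hf, hg, mul_assoc]

/-- The inverse of a `u`-equivariant bijection is `u⁻¹`-equivariant.
([IUTchI] Def 6.1 (v) p.158) [claim: Mochizuki2012, status: disputed] -/
theorem unitEquivariant_symm {u : (ZMod l)ˣ} {f : S ≃ S'}
    (hf : ∀ (q : ZMod l) (s : S), f (q +ᵥ s) = ((u : ZMod l) * q) +ᵥ f s) :
    ∀ (q : ZMod l) (s : S'), f.symm (q +ᵥ s) = (((u⁻¹ : (ZMod l)ˣ) : ZMod l) * q) +ᵥ f.symm s :=
  fun q s => by
  apply f.injective
  rw [Equiv.apply_symm_apply, hf, Equiv.apply_symm_apply, ← mul_assoc, Units.mul_inv, one_mul]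

/-- The factor of an INJECTIVE unit-equivariant map is a unit of `ℤ/l` (`l ≠ 0`): read the map on one orbit.
([IUTchI] Def 6.1 (v) p.158) [claim: Mochizuki2012, status: disputed] -/
theorem isUnit_of_unitEquivariant_injective [NeZero l] {u : ZMod l} {f : S → S'}
    (hf : ∀ (q : ZMod l) (s : S), f (q +ᵥ s) = (u * q) +ᵥ f s) (hinj : Function.Injective f) :
    IsUnit u := by
  obtain ⟨s⟩ := (inferInstance : Nonempty S)
  have hinj' : Function.Injective fun q : ZMod l => u * q := by
    intro q q' h
    have h2 : f (q +ᵥ s) = f (q' +ᵥ s) := by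
      rw [hf, hf]
      exact congrArg (· +ᵥ f s) h
    exact vadd_right_cancel s (hinj h2)
  obtain ⟨q, hq⟩ := (Finite.injective_iff_surjective.mp hinj') 1
  exact isUnit_iff_exists_inv.mpr ⟨q, hq⟩

/-- **(L4), rigidity**: a SIGN-equivariant self-bijection fixing all cusps has sign `+1` (for `2 < l`; for `l ≤ 2`
the sign `−1` acts trivially on `ℤ/l`). ([IUTchI] Def 6.1 (iii) p.157) [claim: Mochizuki2012, status: disputed] -/
theorem IsSemiEquivariant.eq_one_of_forall_eq (hl : 2 < l) {ε : ℤˣ} {f : S ≃ S}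
    (hf : IsSemiEquivariant (l := l) ε f) (hid : ∀ s, f s = s) : ε = 1 := by
  rw [isSemiEquivariant_iff_cast] at hf
  have h := unitEquivariant_eq_one_of_forall_eq hf hid
  rcases Int.units_eq_one_or ε with rfl | rfl
  · rfl
  · exfalso
    rw [Units.val_neg, Units.val_one, Int.cast_neg, Int.cast_one] at h
    -- `-1 = 1` in `ZMod l` forces `l ∣ 2`
    have h2 : ((2 : ℕ) : ZMod l) = 0 := by
      rw [Nat.cast_ofNat]
      calc (2 : ZMod l) = 1 + 1 := one_add_one_eq_two.symm
        _ = 1 + -1 := by nth_rw 2 [← h]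
        _ = 0 := add_neg_cancel 1
    rw [ZMod.natCast_eq_zero_iff] at h2
    exact absurd (Nat.le_of_dvd two_pos h2) (not_le.mpr hl)

namespace FlPMTorsor

/-- Pulling a chart of the cusp-torsor structure (P3 `FlPMTorsor.ofAddTorsor`: the sign-affine bijections) back
along a `u`-equivariant bijection gives a chart IFF `u = ±1` ([IUTchI] Prop 6.5 (i) p.163 "compatible with the
respective `𝔽_l^±`-torsor structures" holds exactly for the automorphisms in `Aut_±`).
([IUTchI] Def 6.1 (v) p.158) [claim: Mochizuki2012, status: disputed] -/
theorem trans_mem_ofAddTorsor_charts_iff [Nonempty S] [Nonempty S'] {u : ZMod l} {f : S ≃ S'}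
    (hf : ∀ (q : ZMod l) (s : S), f (q +ᵥ s) = (u * q) +ᵥ f s) {e : S' ≃ ZMod l}
    (he : e ∈ (ofAddTorsor l S').charts) :
    f.trans e ∈ (ofAddTorsor l S).charts ↔ u = 1 ∨ u = -1 := by
  obtain ⟨η, hη⟩ := he
  obtain ⟨s⟩ := (inferInstance : Nonempty S)
  constructor
  · rintro ⟨ε, hε⟩
    -- compare the two readings of `e (f (1 +ᵥ s))`: `η·u = ε` with `η, ε ∈ {±1}`
    have h := hε 1 s
    rw [Equiv.trans_apply, Equiv.trans_apply, hf, hη, mul_one, Units.smul_def, Units.smul_def,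
      zsmul_eq_mul, zsmul_eq_mul, mul_one, add_left_inj] at h
    rcases Int.units_eq_one_or η with rfl | rfl <;> rcases Int.units_eq_one_or ε with rfl | rfl
    · left
      simpa only [Units.val_one, Int.cast_one, one_mul] using h
    · right
      simpa only [Units.val_one, Units.val_neg, Int.cast_one, Int.cast_neg, one_mul] using h
    · right
      simp only [Units.val_one, Units.val_neg, Int.cast_one, Int.cast_neg, neg_one_mul] at h
      exact neg_eq_iff_eq_neg.mp h
    · left
      simpa only [Units.val_neg, Units.val_one, Int.cast_neg, Int.cast_one, neg_one_mul, neg_inj] using h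
  · rintro (rfl | rfl)
    · exact ⟨η, fun q t => by
        rw [Equiv.trans_apply, Equiv.trans_apply, hf, one_mul, hη]⟩
    · exact ⟨-η, fun q t => by
        rw [Equiv.trans_apply, Equiv.trans_apply, hf, hη, Units.smul_def, Units.smul_def,
          zsmul_eq_mul, zsmul_eq_mul, Units.val_neg, Int.cast_neg, neg_one_mul, mul_neg,
          neg_mul]⟩

/-- **Torsor side of `gLab_range`**: a `u`-equivariant permutation of a cusp torsor lies in `Aut_±(T)` (P3's
torsor structure) IFF `u = ±1` ([IUTchI] Def 6.1 (v) p.158: the automorphisms whose image in `𝔽_l^⋇` is trivial are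
those acting on `LabCusp^±` through `𝔽_l^{⋊±}`).
([IUTchI] Def 6.1 (v) p.158) [claim: Mochizuki2012, status: disputed] -/
theorem mem_autPM_iff_of_unitEquivariant [Nonempty S] {u : ZMod l} {f : S ≃ S}
    (hf : ∀ (q : ZMod l) (s : S), f (q +ᵥ s) = (u * q) +ᵥ f s) :
    (f : Equiv.Perm S) ∈ (ofAddTorsor l S).autPM ↔ u = 1 ∨ u = -1 := by
  obtain ⟨s₀⟩ := (inferInstance : Nonempty S)
  constructor
  · intro h
    obtain ⟨g, hg⟩ := h _ (vsub_mem_ofAddTorsor_charts S s₀)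
    -- read `f` in the difference chart at `s₀`: `f t -ᵥ s₀ = g • (t -ᵥ s₀)`
    have h0 : f s₀ -ᵥ s₀ = g.left.toAdd := by
      have h := hg s₀
      simp only [Equiv.coe_vaddConst_symm, vsub_self, FlPM.smul_def, smul_zero, zero_add] at h
      exact h
    have h1 : u + (f s₀ -ᵥ s₀) = g.right • (1 : ZMod l) + g.left.toAdd := by
      have h := hg ((1 : ZMod l) +ᵥ s₀)
      simp only [Equiv.coe_vaddConst_symm, vadd_vsub, hf, mul_one, vadd_vsub_assoc,
        FlPM.smul_def] at h
      exact h
    rw [h0, add_left_inj, Units.smul_def, zsmul_eq_mul, mul_one] at h1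
    rcases Int.units_eq_one_or g.right with hr | hr
    · left
      rw [h1, hr, Units.val_one, Int.cast_one]
    · right
      rw [h1, hr, Units.val_neg, Units.val_one, Int.cast_neg, Int.cast_one]
  · rintro (rfl | rfl)
    · exact mem_autPM_of_semiEquivariant (ε := 1)
        ((isSemiEquivariant_iff_cast 1 f).mpr (by simpa using hf))
    · exact mem_autPM_of_semiEquivariant (ε := -1)
        ((isSemiEquivariant_iff_cast (-1) f).mpr (by simpa using hf))

/-- The same with the factor a unit `u ∈ (ℤ/l)^×` and the conclusion read in `𝔽_l^⋇`: `f ∈ Aut_±(T)` IFF the label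
of `u` is trivial — so, at the instance, `Aut_±(𝒟^{⊚±}) = Ker(toFlStar)` is exactly the set of automorphisms
acting on `LabCusp^±(𝒟^{⊚±})` inside `Aut_±` of the torsor (`gLab_range`), and `autCsp_le` follows from
`unitEquivariant_eq_one_of_forall_eq`. ([IUTchI] Def 6.1 (v) p.158) [claim: Mochizuki2012, status: disputed] -/
theorem mem_autPM_iff_mk_eq_one [Nonempty S] {u : (ZMod l)ˣ} {f : S ≃ S}
    (hf : ∀ (q : ZMod l) (s : S), f (q +ᵥ s) = ((u : ZMod l) * q) +ᵥ f s) :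
    (f : Equiv.Perm S) ∈ (ofAddTorsor l S).autPM ↔ FlStar.mk l u = 1 := by
  rw [mem_autPM_iff_of_unitEquivariant hf, FlStar.mk_eq_one_iff_val]

/-- **(L4)**, the converse of P3's `mem_autPM_of_semiEquivariant`: every element of `Aut_±(T)` of a cusp torsor is
SIGN-equivariant for the `ℤ/l`-action (read it in a difference chart: `z ↦ ±z + λ`); no hypothesis on `l`.
([IUTchI] Def 6.1 (v) p.158) [claim: Mochizuki2012, status: disputed] -/
theorem exists_semiEquivariant_of_mem_autPM [Nonempty S] {f : S ≃ S}
    (hf : (f : Equiv.Perm S) ∈ (ofAddTorsor l S).autPM) :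
    ∃ ε : ℤˣ, IsSemiEquivariant (l := l) ε f := by
  obtain ⟨s₀⟩ := (inferInstance : Nonempty S)
  obtain ⟨g, hg⟩ := hf _ (vsub_mem_ofAddTorsor_charts S s₀)
  refine ⟨g.right, fun q s => ?_⟩
  -- in the difference chart at `s₀`, `f` reads `z ↦ g • z`
  have key : ∀ t : S, f t = (g • (t -ᵥ s₀)) +ᵥ s₀ := fun t => by
    have h := hg t
    simp only [Equiv.coe_vaddConst_symm] at h
    rw [← h, vsub_vadd]
  rw [key (q +ᵥ s), key s, vadd_vsub_assoc, vadd_vadd, FlPM.smul_def, FlPM.smul_def, smul_add,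
    add_assoc]

/-- **(L4), rigidity in `𝔽_l^{⋊±}`**: for `2 < l`, if a permutation reads in some chart of an `𝔽_l^±`-torsor as the
element `g ∈ 𝔽_l^{⋊±}` and acts trivially, then `g = 1` ("acts trivially on the torsor ⇒ is the identity of
`𝔽_l^{⋊±}`"; faithfulness `FlPM.toPerm_injective`). ([IUTchI] Def 6.1 (i) p.155) [claim: Mochizuki2012, status: disputed] -/
theorem eq_one_of_forall_chart_smul_eq (hl : 2 < l) {T : Type*} (e : T ≃ ZMod l) {g : FlPM l}
    (hg : ∀ t, e t = g • e t) : g = 1 := by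
  apply FlPM.toPerm_injective hl
  ext z
  rw [FlPM.toPerm_apply, FlPM.toPerm_apply, one_smul]
  have h := hg (e.symm z)
  rw [Equiv.apply_symm_apply] at h
  exact h.symm

/-- Hence an element of `Aut_±(T)` acting trivially reads as `1 ∈ 𝔽_l^{⋊±}` in EVERY chart: the element `g` that
`mem_autPM` provides for a chart is `1` (for `2 < l`). ([IUTchI] Def 6.1 (i) p.155) [claim: Mochizuki2012, status: disputed] -/
theorem smul_eq_one_of_mem_autPM_of_forall_eq (hl : 2 < l) {T : Type*} (X : FlPMTorsor l T)
    {σ : Equiv.Perm T} (hid : ∀ t, σ t = t) {e : T ≃ ZMod l} (he : e ∈ X.charts) {g : FlPM l}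
    (hg : ∀ t, e (σ t) = g • e t) : g = 1 := by
  have _ := X.trans_toPerm_mem he
  exact eq_one_of_forall_chart_smul_eq hl e fun t => by rw [← hg t, hid]

end FlPMTorsor

end UnitEquivariant

end Literature.IUT.HodgeTheaters
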